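import Summits.QuantumFields.YangMills.Theorems.FemtoCutoffLadderCoarsePairScalingGlue

/-!
# Route `FemtoCutoffLadder` after the rev-11 nested split — THE SHORT ASSEMBLY: `NestedStepUpper → NestedStepLower → FixedLatticeLaw →
# FemtoGapOfRecord` (the dyadic tower `OctaveStepDecay`, the ratio window of `SubOctaveBounded` and the one-site anchor are NOT load-bearing)

Lead seat `ym-line-fcl-p1` g8 (2026-08-28); kernel certificate of critic idea-crit-4's price P1 on route rev 11→12 (04:40Z): once the
incommensurable step is split into the two NESTED steps `NestedStepUpper` (stmt-QuantumFields-25608: `z(β, mL') ≤ z(β', L') + CΛ²`) and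
`NestedStepLower` (stmt-QuantumFields-25609: `z(β, mL') ≥ z(β', L') − CΛ²`), every lattice `L ≥ M` reaches the fixed base lattice
`M := max(L₀ᵁ, L₀ᴸ, 1)` through the COMMON REFINEMENT `M·L`:

  `z(β, L) ≥ z(β_F, M·L) − C_U Λ²`   (Upper at coarse `L`, fine `M·L`, ratio `M`; matched `β_F` by `matchedCouplingExists_proof`)
  `z(β_F, M·L) ≥ z(β_M, M) − C_L Λ²`  (Lower at coarse `M`, fine `L·M`, ratio `L`; matched `β_M`)
  `z(β_M, M) ≥ ε₁Λ − C_M Λ²`          (`FixedLatticeLaw` at the ONE lattice `M`, in window form: `fixedLatticeWindowGap_of_fixedLattice`)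

so `z(β, L) ≥ ε₁Λ − (C_U + C_L + C_M)Λ²` for all `L ≥ M`, which is the rung leaf `FemtoGapOfRecord` (`L₀(lam) := M`, `lam0 = min(lam_U, lam_L,
lam_M, 1/2)`).  Consequences for the plan (lead's release note): after rev 11 the cone of the leaf is {25608, 25609, 23943}; `OctaveStepDecay`
(24153) with its rev-12 children 25695/25696/25697, the ratio window `L' ≤ L < 2L'` of `SubOctaveBounded`, `CoarsePairScaling`'s one-site
partner and the anchor `OneSiteWindowAnchor` are idle for the leaf; and `FixedLatticeLaw` is needed at ONE lattice size `M ≥ max(L₀ᵁ, L₀ᴸ)` only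
(but the children's `L₀`'s are existential, so in practice `∀ L`).

★ `femtoGapOfRecord_of_nested_of_fixedLattice : NestedStepUpper → NestedStepLower → FixedLatticeLaw → FemtoGapOfRecord`;
★ `femtoGapOfRecord_of_nested_of_fixedLatticeAt` — the sharper form with the fixed-lattice law assumed at the single base lattice only.

HONEST FRAMING: bookkeeping (real analysis over the tree's positivity lemmas); neither nested step nor the fixed-lattice law at any `L ≥ 2` is
proved here — `NestedStepLower` at unbounded ratio is leaf-strength two-cutoff control of the first zero-flux level (barrier
`UVStabilityNonUniqueness`).  R2b1 is a RECORD rung — not infinite volume, not a mass gap, not Clay; no summit is proved by this line.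
No definitions, no named facts, no `sorry`.
-/

set_option autoImplicit false

noncomputable section

namespace Summit.QuantumFields.YangMills.Theorems.FemtoCutoffLadder

open Real
open Summit.QuantumFields.YangMills.Theorems.FemtoTransferGap
open Summit.QuantumFields.YangMills.Theses.FemtoCutoffLadder
open Literature.Analysis.OperatorTheory.YMMatrixModel (luscherEps1)

/-- ★ **The short assembly with the fixed-lattice law at ONE base lattice.**  From `NestedStepUpper` (25608), `NestedStepLower` (25609) and
the fixed-lattice law IN WINDOW FORM at a single lattice size `M` lying above both children's thresholds, the rung leaf `FemtoGapOfRecord`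
follows with `L₀(lam) := M`: pass `L ≥ M` through the common refinement `M·L` (Upper at ratio `M`, Lower at ratio `L`, matched couplings
from `matchedCouplingExists_proof`), multiply the three cross-multiplied inequalities, cancel the positive top values and take `L`-th roots.
[cite: LuscherWeiszWolff1991] [cite: Luscher1983, §3] -/
theorem femtoGapOfRecord_of_nested_of_fixedLatticeAt
    {CU lamU : ℝ} {L0U : ℕ} (hlamU : 0 < lamU)
    (HU : ∀ lam : ℝ, 0 < lam → lam ≤ lamU → ∀ (m : ℕ) (L' : ℕ) [NeZero L'] (L : ℕ) [NeZero L], L0U ≤ L' → L = m * L' →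
      ∀ β β' : ℝ, InFemtoWindow lam β L → InFemtoWindow lam β' L' → luscherLambda β L = luscherLambda β' L' →
        secondValue su2Rep L' β' ^ L' * topValue su2Rep L β ^ L ≤
          Real.exp (CU * luscherLambda β L ^ 2) * (secondValue su2Rep L β ^ L * topValue su2Rep L' β' ^ L'))
    {CL lamL : ℝ} {L0L : ℕ} (hlamL : 0 < lamL)
    (HL : ∀ lam : ℝ, 0 < lam → lam ≤ lamL → ∀ (m : ℕ) (L' : ℕ) [NeZero L'] (L : ℕ) [NeZero L], L0L ≤ L' → L = m * L' →
      ∀ β β' : ℝ, InFemtoWindow lam β L → InFemtoWindow lam β' L' → luscherLambda β L = luscherLambda β' L' →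
        secondValue su2Rep L β ^ L * topValue su2Rep L' β' ^ L' ≤
          Real.exp (CL * luscherLambda β L ^ 2) * (secondValue su2Rep L' β' ^ L' * topValue su2Rep L β ^ L))
    (M : ℕ) [NeZero M] (hMU : L0U ≤ M) (hML : L0L ≤ M)
    {CM lamM : ℝ} (hlamM : 0 < lamM)
    (HM : ∀ lam : ℝ, 0 < lam → lam ≤ lamM → ∀ β : ℝ, InFemtoWindow lam β M →
      secondValue su2Rep M β ^ M ≤ Real.exp (-(zLower CM β M)) * topValue su2Rep M β ^ M) :
    FemtoGapOfRecord := by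
  have hMat : MatchedCouplingExists := matchedCouplingExists_proof
  refine ⟨CU + CL + CM, min (min lamU lamL) (min lamM (1 / 2)),
    lt_min (lt_min hlamU hlamL) (lt_min hlamM (by norm_num)), ?_⟩
  intro lam hlam hle
  refine ⟨M, ?_⟩
  intro L _ hMLe β hW
  have hleU : lam ≤ lamU := hle.trans ((min_le_left _ _).trans (min_le_left _ _))
  have hleL : lam ≤ lamL := hle.trans ((min_le_left _ _).trans (min_le_right _ _))
  have hleM : lam ≤ lamM := hle.trans ((min_le_right _ _).trans (min_le_left _ _))
  have hleh : lam ≤ 1 / 2 := hle.trans ((min_le_right _ _).trans (min_le_right _ _))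
  -- the common refinement `F = M * L` and the two matched couplings
  haveI : NeZero (M * L) := ⟨Nat.mul_ne_zero (NeZero.ne M) (NeZero.ne L)⟩
  obtain ⟨βF, hWF, hmF⟩ := hMat lam hlam hleh L (M * L) β hW
  obtain ⟨βM, hWM, hmM⟩ := hMat lam hlam hleh (M * L) M βF hWF
  -- Upper: coarse `L` (≥ L0U since L ≥ M), fine `M * L`, ratio `M`
  have h1 := HU lam hlam hleU M L (M * L) (hMU.trans hMLe) rfl βF β hWF hW hmF
  -- Lower: coarse `M`, fine `L * M = M * L`, ratio `L`
  have h2 := HL lam hlam hleL L M (M * L) hML (Nat.mul_comm M L) βF βM hWF hWM hmM.symm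
  -- fixed lattice `M`
  have h3 := HM lam hlam hleM βM hWM
  -- names and positivity
  set a := secondValue su2Rep L β ^ L
  set b := topValue su2Rep L β ^ L
  set aF := secondValue su2Rep (M * L) βF ^ (M * L)
  set bF := topValue su2Rep (M * L) βF ^ (M * L)
  set aM := secondValue su2Rep M βM ^ M
  set bM := topValue su2Rep M βM ^ M
  have hb : 0 ≤ b := pow_nonneg (topValue_su2Rep_pos _ _).le _
  have hbF : 0 < bF := pow_pos (topValue_su2Rep_pos _ _) _
  have hbM : 0 < bM := pow_pos (topValue_su2Rep_pos _ _) _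
  set e₁ := Real.exp (CU * luscherLambda βF (M * L) ^ 2)
  set e₂ := Real.exp (CL * luscherLambda βF (M * L) ^ 2)
  set e₃ := Real.exp (-(zLower CM βM M))
  have he₁ : 0 ≤ e₁ := (Real.exp_pos _).le
  have he₂ : 0 ≤ e₂ := (Real.exp_pos _).le
  -- chain: `a·bF·bM ≤ e₁·aF·b·bM ≤ e₁·b·e₂·aM·bF ≤ e₁ e₂ e₃ · b · bM · bF`
  have key : a * bF * bM ≤ e₁ * e₂ * e₃ * b * (bF * bM) := by
    have c1 : a * bF * bM ≤ e₁ * (aF * b) * bM := mul_le_mul_of_nonneg_right h1 hbM.le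
    have c2 : e₁ * (aF * b) * bM ≤ e₁ * b * (e₂ * (aM * bF)) := by
      have := mul_le_mul_of_nonneg_left h2 (mul_nonneg he₁ hb)
      calc e₁ * (aF * b) * bM = e₁ * b * (aF * bM) := by ring
        _ ≤ _ := this
    have c3 : e₁ * b * (e₂ * (aM * bF)) ≤ e₁ * b * (e₂ * (e₃ * bM * bF)) := by
      have h3' : aM * bF ≤ e₃ * bM * bF := mul_le_mul_of_nonneg_right h3 hbF.le
      exact mul_le_mul_of_nonneg_left (mul_le_mul_of_nonneg_left h3' he₂) (mul_nonneg he₁ hb)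
    calc a * bF * bM ≤ _ := c1
      _ ≤ _ := c2
      _ ≤ _ := c3
      _ = e₁ * e₂ * e₃ * b * (bF * bM) := by ring
  have key' : a ≤ e₁ * e₂ * e₃ * b := by
    have : a * (bF * bM) ≤ e₁ * e₂ * e₃ * b * (bF * bM) := by
      calc a * (bF * bM) = a * bF * bM := by ring
        _ ≤ _ := key
    exact le_of_mul_le_mul_right this (mul_pos hbF hbM)
  -- all three running parameters coincide
  have hΛF : luscherLambda βF (M * L) = luscherLambda β L := hmF
  have hΛM : luscherLambda βM M = luscherLambda β L := hmM.trans hmF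
  have hexp : e₁ * e₂ * e₃ = Real.exp (-(zLower (CU + CL + CM) β L)) := by
    simp only [e₁, e₂, e₃, ← Real.exp_add, zLower, hΛF, hΛM]
    ring_nf
  rw [hexp] at key'
  exact CutoffLadder.root_of_pow_le (secondValue_su2Rep_pos (L := L) (by linarith [hW.1])).le
    (topValue_su2Rep_pos L β).le key'

/-- ★★ **THE SHORT ASSEMBLY of route `FemtoCutoffLadder` after rev 11**: `NestedStepUpper → NestedStepLower → FixedLatticeLaw →
FemtoGapOfRecord` — base lattice `M := max(L₀ᵁ, L₀ᴸ) + 1`, fixed-lattice law in window form at `M` from the tree conversion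
`fixedLatticeWindowGap_of_fixedLattice` (bare → running label at fixed `L`), matching from `matchedCouplingExists_proof`.  The dyadic tower
`OctaveStepDecay` (24153) and everything split off it (25695–25697), the ratio window of `SubOctaveBounded` (24085), `CoarsePairScaling`'s one-site
half and the anchor are not used. [cite: LuscherWeiszWolff1991] [cite: Luscher1983, §3] -/
theorem femtoGapOfRecord_of_nested_of_fixedLattice (hU : NestedStepUpper) (hL : NestedStepLower) (hF : FixedLatticeLaw) :
    FemtoGapOfRecord := by
  obtain ⟨CU, lamU, L0U, hlamU, HU⟩ := hU
  obtain ⟨CL, lamL, L0L, hlamL, HL⟩ := hL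
  set M : ℕ := max L0U L0L + 1 with hMdef
  haveI : NeZero M := ⟨Nat.succ_ne_zero _⟩
  have hMU : L0U ≤ M := (le_max_left _ _).trans (Nat.le_succ _)
  have hML : L0L ≤ M := (le_max_right _ _).trans (Nat.le_succ _)
  have hFL : FemtoGapFixedLattice := fun L _ => hF L
  obtain ⟨CM, lamM, hlamM, HM⟩ := fixedLatticeWindowGap_of_fixedLattice hFL M
  exact femtoGapOfRecord_of_nested_of_fixedLatticeAt hlamU HU hlamL HL M hMU hML hlamM HM

end Summit.QuantumFields.YangMills.Theorems.FemtoCutoffLadder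

end
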